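import Summits.BirchSwinnertonDyer.Rank1Residual.F1Sign2.DescentSignAtTwo
import Literature.NumberTheory.EllipticCurves.BSDQuotientOverNumberField
import HarnessLib

/-!
# Cell `bsd-f1-sign2` — descent lens (planner `-desc`, g7; MEMO-desc §15): the Cassels–Tate sign of admissible twists at two

STATEMENTS ONLY (two support predicates with bodies, one numerical ∃-fact as a plain `def`, ONE `@[conjecture]` candidate DESC-N; nothing asserted, no proof, no named fact; typer filing of the planner's Sketch-v7 in the cut fixed by REF1 §32 — see the end of this docstring).

One level below the cell's descent sign `ε(W)`: on the odd branch `ε(W) = −1` every admissible twist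
`W^{(d)}` has `#Sel₂ = 8` and `Sel₂(W^{(d)}) ⊂ H¹(ℚ, E[2])` is the `d`-independent relaxed space `R`
(`dim 3 ⊃ Sel₂(W) = Ш(W)[2]`), but the Cassels–Tate form `CT_d` on `R` — equivalently the bit
`θ(W^{(d)}) := [Ш(W^{(d)})[2] ⊆ 2·Ш(W^{(d)})[4]]` (PARI `ellrank` `s = 0`; Fisher 2022 Gram matrix `= 0`) —
DEPENDS ON `d` (kit `j290597`, two engines; D8 `j285752`: `360693d1` `d = −347 ↦ s = 2`, `d = −479 ↦ s = 0`).
Rows filed here: DESC-M⁻ `AdmissibleTwistCasselsTateSignVariesAtTwo` (the certified census ∃-fact, plain `def`), DESC-N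
`OddBranchTwistShaAnBitAtTwo` (`@[conjecture]`; the BSD₂ bit the sign decides for the rank-1 twist: `#Ш_an(W^{(d)}) ≡ 4 (8)` vs `16 ∣ #Ш_an`).
NOT filed (REF1 §32): DESC-M «the sign is d-independent on the odd branch» — REFUTED NUMERICALLY by the planner's own two engines (8/8 X5
odd-branch classes + 76/81 Cremona ε = −1 curves carry both signs; witnesses in the docstring of DESC-M⁻), kept out of the conjecture column;
DESC-O_k (elementary governing law of level `2^k`, refuted for `k ≤ 7`: 135877h1 q = 503/839, 80965b1 q = 1171/9491) — MEMO only. Informal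
companion (memo §15.4): a GOVERNING FIELD for `θ(W^{(−q)})` (EC analogue of Cohn–Lagarias / Stevenhagen for 4- and 8-ranks of class groups;
Smith 2022: none for 16-ranks). Data: kit j290725 / j290841 / j290862 / j290912 (tag bsd-frontier-data; 14 676 curve-rows; ENGINE CT-2 =
Fisher 2022 Thm 3.1 Gram matrix vs PARI `ellrank` agree 14 676/14 676; TABLE-CT7-EPS2-v1 5fd7136cfb785ccf; tables + SHA16SUMS in
`HOME/MEMO-desc-data/g7/`): density of `θ = +` among admissible twists on `d ≡ 1 (8)` = 271/2 283 = 0.119 [0.106, 0.133]; Rédei/Smith affine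
additivity blind test: 0 square-quadruples with three `θ = +` out of 3 564.

TYPER FILING (seat `bsd-f1-sign2-ty` g2; CANDIDATES.md rows DESC-§15-M⁻ / DESC-§15-N): bodies VERBATIM from `HOME/MEMO-desc-data/g7/Sketch-v7.lean`
94a8ee0985cc4f47 (-desc g7 2026-08-27T21:29:37Z; lean rc 0 · 0 warn · 0 sorry; BC7 `g7/bc7.out` 6b3d0599c6ecbf10 4/4 CLEAN vs
`ByReductionTypeAtTwo.RankOneAtTwo`), minus the two refuted rows and their glue (`not_constancy_of_varies`, `elementaryLaw_mono`), DESC-N given the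
`@[conjecture]` attribute (cell convention). REF1-AUDIT-v1 §32 (b3b3d193f49868d9, 21:59:25Z; evidence `HOME/REF1-data/b29/`): `ShaTwoInTwiceShaFour` /
`OnOddBranchAtTwo` CORRECT; DESC-M dead — docstring of DESC-M⁻ only; DESC-M⁻ numerical ∃-fact (plain def); **DESC-N SURVIVES conjecture-grade**
(= BSD₂ on the twist family via the Cassels–Tate structure: `θ = −` ⟺ `#Ш ≡ 4 (8)`, `θ = +` ⟺ `16 ∣ #Ш` — residues exactly right); DESC-O_k
MEMO only. REF2-PLACEMENT v16 §4 (8670aa9294006c63, 2026-08-27T21:42:18Z) + §13 (abe7c28f2fc3113a, slot read of this file: consistent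
on substance; this sentence replaces the stale «placement pending» slot): MEMO-desc §15 PLACED — Smith, JAMS I (doi:10.1090/jams/1062 =
arXiv:2207.05674, held) Assumption 1.1 (1) covers `E(ℚ)[2] = 0`; Thm 1.5 / Heuristic 4.16 ⇒ the density of `θ = +` on the odd branch is
PREDICTED `P^Alt(3∣3) = 1/8` (observed 0.119 [0.106, 0.133] ∋ 0.125); the §15 F6 affine additivity is IN PRINT AS A MECHANISM (Smith I
Def 7.2 + Thm 8.12, «zero-sums-in-lines» for governing expansions), verbatim only for full rational 2-torsion (Smith 2016 Thm 3.2);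
Conjecture G = variant / corollary-candidate; DESC-M⁻ / DESC-N NOT in print as objects; beyond-print theorem: no.
Bib key `Fisher2022quartics` (T. Fisher, «On binary quartics and the Cassels–Tate pairing», Res. Number Theory 8 (2022) no. 4, Paper 74;
arXiv:2208.14977) added. PARTITION: none moved; beyond-print theorem: no.
bears_on: `stmt-BirchSwinnertonDyer-19099` `RankOneAtTwo` (DESC-N is its wuc-type consequence on the rank-1 admissible twists of odd-branch curves).
-/

noncomputable section

open scoped Classical

open WeierstrassCurve Literature.NumberTheory.EllipticCurves

namespace Summit.BirchSwinnertonDyer.Rank1Residual.F1Sign2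

/-- `θ(V) = +1`: `Ш(V)[2] ⊆ 2·Ш(V)[4]` — every `2`-torsion class of `Ш(V)` is twice a `4`-torsion class of `Ш(V)`
(the Cassels–Tate form on `Sel₂(V)` vanishes identically; PARI `ellrank(V) = [r,R,s,L]` with `s = 0`). -/
def ShaTwoInTwiceShaFour (V : WeierstrassCurve ℚ) : Prop :=
  ∀ c ∈ V.sha, (2 : ℕ) • c = 0 → ∃ c' ∈ V.sha, (4 : ℕ) • c' = 0 ∧ (2 : ℕ) • c' = c

/-- The ODD BRANCH `X⁻` of the cell's habitat: `Δ > 0`, `E(ℚ)[2] = 0`, rank `0`, `#Sel₂(W) = 4` (so `Ш(W)[2] ≅ (ℤ/2)²`)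
and `ε(W) = −1`, i.e. every admissible twist has `#Sel₂(W^{(d)}) = 8` (tree `DescAdmissible`, `twistSelmerTwoCard`). -/
def OnOddBranchAtTwo (W : WeierstrassCurve ℚ) [W.IsGloballyMinimal] : Prop :=
  0 < W.Δ ∧ NoRationalTwoTorsion W ∧ W.mordellWeilRank = 0 ∧ selmerTwoCard W = 4 ∧
    ∀ d : ℤ, DescAdmissible W d → twistSelmerTwoCard W d = 8

/-- **DESC-M⁻ `AdmissibleTwistCasselsTateSignVariesAtTwo` (numerical ∃-fact, two engines; plain def, nothing asserted).** There is
a curve on the odd branch with two admissible twists of opposite Cassels–Tate sign (`360693d1`, `d = −479` vs `d = −347`). This is the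
typed NEGATION of DESC-M «on the odd branch the Cassels–Tate sign of the admissible twists is `d`-independent» (the order-4 analogue of
DESC-F′), REFUTED NUMERICALLY and therefore not declared: witnesses (PARI `ellrank` s, GRH-free for s; Fisher-2022 engine CT-2 as second
engine, kit `j290597`): `360693d1`: `θ(W^{(−347)}) = −1`, `θ(W^{(−479)}) = +1`; `376465k1`: `−191 ↦ −1`, `−291 ↦ +1`; `452177e1`:
`−95 ↦ +1`, `−107 ↦ −1`; in all, 8/8 X5 odd-branch classes and 76/81 Cremona `ε = −1` curves carry both signs.
[cite: Fisher2022quartics, Thm. 3.1 (the pairing formula both engines implement)] -/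
def AdmissibleTwistCasselsTateSignVariesAtTwo : Prop :=
  ∃ (W : WeierstrassCurve ℚ) (_ : W.IsElliptic) (_ : W.IsGloballyMinimal), OnOddBranchAtTwo W ∧
    ∃ d d' : ℤ, DescAdmissible W d ∧ DescAdmissible W d' ∧
      ShaTwoInTwiceShaFour (W.quadraticTwist (d : ℚ)) ∧ ¬ ShaTwoInTwiceShaFour (W.quadraticTwist (d' : ℚ))

/-- **DESC-N `OddBranchTwistShaAnBitAtTwo` (the BSD₂ bit the sign decides; wuc-type consequence of `RankOneAtTwo` for the
rank-1 admissible twists of odd-branch curves).** For `W` on the odd branch, admissible `d`, and `W'` a globally minimal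
model of `W^{(d)}` of analytic rank `1`: `θ(W') = +1 ⇒ #Ш_an(W') ∈ 16ℕ`, `θ(W') = −1 ⇒ #Ш_an(W') ≡ 4 (mod 8)`
(`Ш(W')[2] ≅ (ℤ/2)²` by T-A; census D8 13/13: s = 2 ↔ Ш_an = 4 (10), s = 0 ↔ Ш_an = 16 (3); kit `j290597` adds the
Cremona-internal pairs). [cite: GrossZagier1986, V (2.2) (Ш_an of the rank-1 twist via the Heegner index)] -/
@[conjecture] def OddBranchTwistShaAnBitAtTwo : Prop :=
  ∀ (W : WeierstrassCurve ℚ) [W.IsElliptic] [W.IsGloballyMinimal], OnOddBranchAtTwo W →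
    ∀ d : ℤ, DescAdmissible W d →
      ∀ (W' : WeierstrassCurve ℚ) [W'.IsElliptic] [W'.IsGloballyMinimal],
        (∃ C : VariableChange ℚ, C • W.quadraticTwist (d : ℚ) = W') → W'.analyticRank = 1 →
          (ShaTwoInTwiceShaFour W' → ∃ n : ℕ, shaAn W' = (n : ℂ) ∧ 16 ∣ n) ∧
          (¬ ShaTwoInTwiceShaFour W' → ∃ n : ℕ, shaAn W' = (n : ℂ) ∧ n % 8 = 4)

/-! ### APPEND (-ty g3, T-desc-8): MEMO-desc §16 «THE MORDELL–WEIL KERNEL OF THE CASSELS–TATE FORM» — DESC-Θ, DESC-P (lead), DESC-V, helper + 2 proved glue lemmas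

TYPER FILING (seat `bsd-f1-sign2-ty` g3; CANDIDATES.md rows DESC-§16-Θ / DESC-§16-P / DESC-§16-V): bodies VERBATIM from the planner's
`HOME/MEMO-desc-data/g8/Sketch-v8.lean` 6fc2d4340735d291 (-desc g8 2026-08-27T22:25:56Z, MEMO-desc.md 217d003f1beb1905 §16 l.881–932; imports only
this tree file + HarnessLib; lean rc 0 / 0 err / 0 warn / 0 sorry per -desc; BC7 `g8/bc7b.out` 6359066670b12165 3/3 CLEAN; data `MEMO-desc-data/g8/`
TABLE-MWALIGN8-v1 ef7eb38c134fd98d, kit j291953 + j292363 under tag bsd-frontier-data); the only edits are this section header and the cell's filing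
conventions (the two candidates keep the `@[conjecture]` attribute the sketch carries; DESC-V stays a plain `def` ∃-fact; the helper is a `def` with
body; the two glue lemmas are PROVED) and two cite KEYS in the planner's docstring below, normalised to the tree bib: «Smith 2016 arXiv:1607.07860»
↦ `Smith2016GoverningFields` (added this filing) and «Smith JAMS I arXiv:2207.05674» ↦ `Smith2026SelmerTwistI` (JAMS 39 (2026); preprint key
`Smith2022SelmerTwistI`). REF1-AUDIT-v1 §35 (d8008bb9db872353, 2026-08-27T22:53:37Z; evidence `HOME/REF1-data/b32/`: as-is rc 0 / 0 / 0; BC7 CLEAN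
×2 — DESC-Θ shape ∀×6 H×13, DESC-P ∀×5 H×8 ⊢ iff; REF1 recount of TABLE-MWALIGN8-v1: 3 448 unique (class, d), 1 181 square quadruples `#θ+` 712/410/59/0/0,
DESC-P even 1 181/1 181, e-bit = ker₁ = abscissa reading 493/493; TYPED `d ≡ 1 (8)` sub-census 257 quadruples 134/102/21/0/0, 257/257): helper
`EggCasselsTateBitAtTwo` CORRECT; **DESC-Θ `OddBranchCasselsTateSignThreeSumLawAtTwo` SURVIVES → THEOREM-GRADE and hypothesis-free in `W`** (D-ref2-ref1-2
answered YES: (G) `Σᵢ CT_{dᵢ} = 0` on admissible square quadruples is a theorem by Morgan–Smith 2021 Thm 1.3 + Prop 4.4 + two condition-chases — (1)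
`Ext_SMod(M, M)` is 2-torsion (`E + E ≅ M₁ ⊕ M₂` with conditions exactly `𝒲₁ ⊕ 𝒲₂`: kills `4[E_{d₁}]` and makes mixed `d ≡ 1, 5 (8)` quadruples work), (2)
`[E_d] = [E_{d′}] + Ψ(χ_{dd′})` with `Ψ` additive (at `v ∣ 2N∞` the four local objects are identical in the fixed-set model; at `q ∣ d` all `H¹ = 0`); MS21
§6.3.1 graph-conditions cannot arise); **DESC-P `OddBranchEggCasselsTateParityLawAtTwo` SURVIVES in the conjecture column as typed** = (G) + «`θ = −`
admissible twists have rank 1» (⟸ Ш-finiteness; unconditionally only corank 1 + root number −1) — the repair DESC-P′ (four extra clauses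
`¬θ(dᵢ) → rank W^{(dᵢ)} = 1`) is THEOREM-GRADE and loses no census row (to be typed by -desc g9 with the §17 law); DESC-V TRUE, docstring witness
CORRECTED at this port per REF1 (the sketch's `d = −11` is `≡ 5 (8)`, i.e. `DescAdmissibleUnram`, not `DescAdmissible`; replaced by `d = −879`); glue
PROVED (+ REF1 G6: three `θ = +` ⇒ fourth bit `0`). «-ty T-desc-8: OK to append helper + DESC-Θ + DESC-P (`@[conjecture]`) + glue + DESC-V with witness
corrected» — done below; beyond-print theorem: candidate YES ×2 (DESC-Θ′ all-`W`, DESC-P′) pending the 2-page write-up (REF2 v16 §19 concurs: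
literature currency of record (G), DESC-Θ, DESC-P′ = beyond-print THEOREMS (small) by in-print assembly). REF2-PLACEMENT v16 §16 (ce1d1a8e2318f3af, 2026-08-27T22:32:31Z; D-ref2-desc-g8 ANSWERED;
texts Morgan–Smith 2021 arXiv:2103.08530 [MS21], Morgan 2019 arXiv:1706.06063 [Mor19], Smith JAMS I): (b) the affine law (G) «the aligned Cassels–Tate
form is affine in the square class of d on Adm(W)» is NOT in print as stated but is READ AS A THEOREM BY IN-PRINT ASSEMBLY — MS21 Thm 1.3 + Def 4.3 +
**Prop 4.4 (trilinearity `CTP_{E_a+E_b} = CTP_{E_a} + CTP_{E_b}` for Baer sums in SMod_F)** [p0013 L10–46], precedents Kramer 1981 / Mor19 Lemma 38; on the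
odd branch `E_d − E_{d′} = [χ_{dd′} ∪ id_{W[2]}]` is additive in the character, so on every admissible square quadruple `Σ CT_{dᵢ} = 0` (T-G 1 188/1 188
literally, and g7's Conjecture G) — ONE AUDIT POINT for -ref1 and -desc: the SMod-local conditions of the Baer difference at `v ∣ 2N∞` (MS21 §4); if it holds,
(G) is a 1–2 page theorem to be typed as the LEAD PROVABLE statement (-desc g9, MEMO-desc §17, in progress 22:38Z); (a) kernel lemma (K) in print as a
corollary (Cassels 1962 IV; MS21 Thm 1.3 «left kernel π(Sel M)»), real-component / capitulation lemma (V) = Kramer 1981 + the real Kummer map; (c) DESC-P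
NOT in print (Smith's grids never involve generators or real components) but `= res_∞ ∘ (G)` via (K)+(V) ⇒ **beyond-print THEOREM candidate YES (small),
pending -ref1's audit of the local-conditions clause** — kept `@[conjecture]` until audited, «⟸ (G) + (K) + (V), (G) provable from MS21 Prop 4.4»; DESC-Θ =
variant of Smith (as -desc says); (d) the 1/8, 1/2, 3/8, 3/7 laws = corollaries of (G) + (E), (E) = Smith Heur. 4.16 (heuristic in print), the component
laws themselves not in print; nearest prior art in order: Kramer 1981 → Morgan 2019 Lemma 38 → Morgan–Smith 2021 Prop 4.4 → Smith JAMS I Heur. 4.16 /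
Thm 8.12; refuted in print: nothing.
PARTITION: none moved; beyond-print theorem: no; beyond-print conjecture with census: yes (DESC-P). bears_on: `stmt-BirchSwinnertonDyer-19099` (via DESC-N).

The planner's module docstring, verbatim:

# Sketch-v8 (cell `bsd-f1-sign2`, planner `-desc` g8) — the Mordell–Weil kernel of the Cassels–Tate form on the odd branch

Setting (tree `OnOddBranchAtTwo`): `Δ_W > 0`, `E(ℚ)[2] = 0`, rank `0`, `Sel₂(W) = Ш(W)[2] ≅ (ℤ/2)²`, every admissible
twist has `#Sel₂(W^{(d)}) = 8`. Then `R := Sel₂(W^{(d)}) ⊂ H¹(ℚ, E[2])` is the `d`-INDEPENDENT relaxed-at-`∞` Selmer group of `W`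
(`dim 3`) and `S := Sel₂(W) = Ш(W)[2] = {r ∈ R : res_∞ r = 0}` (`dim 2`). Write `θ(d) = +` for `ShaTwoInTwiceShaFour (W^{(d)})`
(Cassels–Tate form `CT_d ≡ 0` on `R`) and `θ(d) = −` otherwise. KERNEL LEMMA (Cassels 1962: `CT` alternating, non-degenerate
modulo divisibles): `θ(d) = − ⇒ rank W^{(d)} = 1, Ш(W^{(d)})[2^∞] ≅ (ℤ/2)²` and `ker CT_d = κ(W^{(d)}(ℚ)) =: ⟨m_d⟩`, the Kummer LINE
of the Mordell–Weil group (kit `j291953`: Fisher-2022 Gram kernel = Kummer class of the PARI point on 524/524 twists, 0 mismatches).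
REAL-COMPONENT LEMMA: `m_d ∈ S ⟺` the generator `P_d ∈ 2·W^{(d)}(ℝ) = W^{(d)}(ℝ)⁰ ⟺ ¬ MeetsEgg (W^{(d)}) ⟺` a non-zero class of
`Ш(W)[2]` capitulates in `ℚ(√d)` (inf–res; `667/667` agreement of the two readings in `j291953`).

GOVERNING CLASS `g_W(d) ∈ R ≅ 𝔽₂³`: `g_W(d) := 0` if `θ(d) = +`, `:= m_d` if `θ(d) = −` (`= ` the vector dual to the alternating
form `CT_d` under `Λ²R^∨ ≅ R`). CENSUS (`HOME/MEMO-desc-data/g8/`, TABLE-MWALIGN8-v1 / POST-MWALIGN8-v1; 89 odd-branch classes,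
3 670 admissible twists, `|d| ≤ 12 000` (A⁺) / `3 000` (C⁻)):
* (G)  `g_W` is AFFINE in the square class of `d`: `Σ g_W(dᵢ) = 0` on **1 188 / 1 188** admissible square quadruples
       (`#θ+ = 0`: 716, `= 1`: 413, `= 2`: 59, `= 3`: 0), including 870/870 quadruples mixing different numbers of prime factors
       (`ω`-patterns `(1,1,1,3)` 9/9, `(1,2,2,3)` 319/319, `(1,2,3,4)` 15/15 …) — i.e. beyond Smith's grid lines;
* (E)  `g_W(d)` is EQUIDISTRIBUTED on the 8 classes of `R` (A⁺: 0.110–0.134 each, C⁻: 0.112–0.137 each; `n = 949 / 2 721`):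
       `P(θ = +) = 1/8` (Smith JAMS I Heur. 4.16: `P^Alt(3|3) = 1/8`), `P(θ = − ∧ generator on the identity component) = 3/8`
       (obs. 0.366 / 0.398), `P(generator of W^{(d)} on the egg) = 1/2` (obs. 0.525 / 0.490);
* (A4) NO elementary law: no linear functional of `g_W(−q)` is a function of `(a_q(W) mod 8, q mod 16)` (0/70 classes; T-A4-MWALIGN8-v1).
Typed rows below are the two shadows of (G) expressible over tree declarations (no `H¹`-level restriction maps in the tree):
DESC-Θ (zero-set of `g_W` is closed under three-term sums = g7's F6 / Smith's zero-sum law) and **DESC-P** (the bit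
`R → R/S ≅ 𝔽₂` of `g_W`, i.e. «`θ(d) = −` and `W^{(d)}(ℚ)` meets the egg», is affine: EVEN on every admissible square quadruple —
1 188/1 188), plus the numerical ∃-fact DESC-V and the proved glue `parityLaw_pair`. Informal companions (memo §16): DESC-G (the
full `𝔽₂³`-law), DESC-E (equidistribution), DESC-K (kernel = Mordell–Weil line), visibility reading.
[cite: Cassels1962ArithmeticIV, Thm 1.2 (alternating)] [cite: Fisher2022quartics, Thm 3.1] [cite: Smith2016GoverningFields, Thm 3.2
(full 2-torsion)] [cite: Smith2026SelmerTwistI, Assumption 1.1(1), Heur. 4.16, Def. 7.2, Thm 8.12] [cite: Kramer1981, Prop. 6]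
-/

/-- The EGG–CASSELS–TATE BIT `e_W(d)` of an admissible twist: `θ(W^{(d)}) = −` (some `2`-torsion class of `Ш(W^{(d)})` is not twice a
`4`-torsion class) AND `W^{(d)}(ℚ)` meets the egg (its generator lies on the non-identity real component). On the odd branch this is the
image of the governing class `g_W(d)` under `R → R/S ≅ 𝔽₂` (kernel lemma + real-component lemma). Model-independent (both conjuncts are
invariant under `VariableChange ℚ`). -/
def EggCasselsTateBitAtTwo (W : WeierstrassCurve ℚ) (d : ℤ) : Prop :=
  ¬ ShaTwoInTwiceShaFour (W.quadraticTwist (d : ℚ)) ∧ MeetsEgg (W.quadraticTwist (d : ℚ))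

/-- **DESC-Θ `OddBranchCasselsTateSignThreeSumLawAtTwo` (conjecture; = memo §15 F6 typed; grade expectation VARIANT of Smith JAMS I
Thm 8.12 / Heur. 4.16 for the `S₃`-image, order-3-Frobenius family).** On the odd branch, for admissible `d₁ … d₄` with `d₁d₂d₃d₄` a square:
if three of the twists have `Ш[2] ⊆ 2Ш[4]` then so does the fourth (the zero-set of `g_W` is closed under three-term sums).
BC5: 0 square quadruples with exactly three `θ = +` among 1 188 (g8, TABLE-MWALIGN8-v1) and among 3 564 (g7, TABLE-CT7c-QUAD-v1);
`#θ+ = 4` does occur in neither table but is predicted with frequency `≈ 1/512` per quadruple.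
REF1-AUDIT §35: SURVIVES and is THEOREM-GRADE, hypothesis-free in `W` — the affine law (G) behind it is a theorem by Morgan–Smith 2021 Thm 1.3 +
Prop 4.4 (trilinearity of the Cassels–Tate pairing in Baer sums) + «`Ext_SMod(M,M)` is 2-torsion» + the local condition-chase at `v ∣ 2N∞`, `q ∣ d`
(REF1 b32; REF2 v16 §16/§19); kept `@[conjecture]` (cell convention: open obligation until the write-up is kernel-checked or filed as a proof).
[cite: MorganSmith2021CTP, Thm 1.3, Def 4.3, Prop 4.4] -/
@[conjecture] def OddBranchCasselsTateSignThreeSumLawAtTwo : Prop :=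
  ∀ (W : WeierstrassCurve ℚ) [W.IsElliptic] [W.IsGloballyMinimal], OnOddBranchAtTwo W →
    ∀ d₁ d₂ d₃ d₄ : ℤ, DescAdmissible W d₁ → DescAdmissible W d₂ → DescAdmissible W d₃ → DescAdmissible W d₄ →
      IsSquare (d₁ * d₂ * d₃ * d₄) →
        ShaTwoInTwiceShaFour (W.quadraticTwist (d₁ : ℚ)) → ShaTwoInTwiceShaFour (W.quadraticTwist (d₂ : ℚ)) →
          ShaTwoInTwiceShaFour (W.quadraticTwist (d₃ : ℚ)) → ShaTwoInTwiceShaFour (W.quadraticTwist (d₄ : ℚ))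

/-- **DESC-P `OddBranchEggCasselsTateParityLawAtTwo` (LEAD CANDIDATE, conjecture).** On the odd branch, for admissible `d₁ … d₄` with
`d₁d₂d₃d₄` a square, the number of `i` with `e_W(dᵢ)` (`θ(W^{(dᵢ)}) = −` and `W^{(dᵢ)}(ℚ)` meets the egg) is EVEN. Mechanism: `e_W = `
(`g_W mod S`) and `g_W` is affine (DESC-G); the bit mixes an order-`4` invariant of `Ш` of the twist with the REAL COMPONENT of its
Mordell–Weil generator (equivalently: with which admissible `ℚ(√dᵢ)` capitulate `Ш(W)[2]`). BC5: even on **1 188 / 1 188** admissible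
square quadruples (A⁺ 233: `#θ+ = 0/1/2`: 142/80/11; C⁻ 955: 574/333/48), the bit read off the Fisher-2022 Gram kernel and, where PARI
found the generator (667 twists), independently off the point's abscissa (agreement 667/667). Why it might fail: a class `W` whose
`4`-Selmer governing expansion has a genuinely quadratic term across `ω(d)` (none in 870 mixed-`ω` quadruples). Not in print: Smith's
laws concern Cassels–Tate values, never Mordell–Weil generators or real components (REF2 v16 §4).
REF1-AUDIT §35: SURVIVES in the conjecture column AS TYPED — it is (G) (a theorem, see DESC-Θ) + «every `θ = −` admissible twist has rank `1`»
(⟸ finiteness of Ш; unconditionally only corank `1` and root number `−1`); the repair DESC-P′ adding the four clauses `¬θ(dᵢ) → rank W^{(dᵢ)} = 1` is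
THEOREM-GRADE and loses no census row (REF1 recount: even on 1 181/1 181 square quadruples, typed `d ≡ 1 (8)` sub-census 257/257). REF2 v16 §16/§19:
not in print; `= res_∞ ∘ (G)` via (K) + (V) ⇒ beyond-print theorem candidate (small). [cite: MorganSmith2021CTP, Thm 1.3, Prop 4.4] -/
@[conjecture] def OddBranchEggCasselsTateParityLawAtTwo : Prop :=
  ∀ (W : WeierstrassCurve ℚ) [W.IsElliptic] [W.IsGloballyMinimal], OnOddBranchAtTwo W →
    ∀ d₁ d₂ d₃ d₄ : ℤ, DescAdmissible W d₁ → DescAdmissible W d₂ → DescAdmissible W d₃ → DescAdmissible W d₄ →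
      IsSquare (d₁ * d₂ * d₃ * d₄) →
        ((EggCasselsTateBitAtTwo W d₁ ↔ EggCasselsTateBitAtTwo W d₂) ↔
          (EggCasselsTateBitAtTwo W d₃ ↔ EggCasselsTateBitAtTwo W d₄))

/-- Proved glue: on a square quadruple whose first two twists have `Ш[2] ⊆ 2Ш[4]` (`θ = +`), DESC-P forces the two remaining twists to
have EQUAL egg–Cassels–Tate bits — in particular two `θ = −` twists completing two `θ = +` twists to a square quadruple have their
generators on the SAME type of real component (census `#θ+ = 2`: 59/59 kernel lines coincide). -/
theorem parityLaw_pair (h : OddBranchEggCasselsTateParityLawAtTwo)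
    (W : WeierstrassCurve ℚ) [W.IsElliptic] [W.IsGloballyMinimal] (hW : OnOddBranchAtTwo W)
    (d₁ d₂ d₃ d₄ : ℤ) (h₁ : DescAdmissible W d₁) (h₂ : DescAdmissible W d₂) (h₃ : DescAdmissible W d₃)
    (h₄ : DescAdmissible W d₄) (hsq : IsSquare (d₁ * d₂ * d₃ * d₄))
    (t₁ : ShaTwoInTwiceShaFour (W.quadraticTwist (d₁ : ℚ))) (t₂ : ShaTwoInTwiceShaFour (W.quadraticTwist (d₂ : ℚ))) :
    (EggCasselsTateBitAtTwo W d₃ ↔ EggCasselsTateBitAtTwo W d₄) := by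
  have key := h W hW d₁ d₂ d₃ d₄ h₁ h₂ h₃ h₄ hsq
  have e₁ : ¬ EggCasselsTateBitAtTwo W d₁ := fun he => he.1 t₁
  have e₂ : ¬ EggCasselsTateBitAtTwo W d₂ := fun he => he.1 t₂
  exact key.mp ⟨fun he => (e₁ he).elim, fun he => (e₂ he).elim⟩

/-- DESC-P also contains the `#θ+ = 3 ⇒` nothing and is COMPATIBLE with DESC-Θ but does not imply it; jointly they are the two shadows of
the `𝔽₂³`-valued law DESC-G that are expressible over tree declarations. The elementary consequence below (an egg bit forces `θ = −`) is
definitional. -/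
theorem ctOdd_of_eggBit {W : WeierstrassCurve ℚ} {d : ℤ} (h : EggCasselsTateBitAtTwo W d) :
    ¬ ShaTwoInTwiceShaFour (W.quadraticTwist (d : ℚ)) := h.1

/-- **DESC-V `OddBranchGeneratorComponentVariesAtTwo` (numerical ∃-fact, two readings; plain def, nothing asserted).** There is a curve on
the odd branch with two admissible `θ = −` twists whose Mordell–Weil groups lie on DIFFERENT real-component types: `80965b1`
(`[0,1,1,−2021561,−1106988059]`), `d = −879` (generator on the egg, Kummer class `m₀ ∉ S`) vs `d = −151` (generator on the identity
component, Kummer class `∈ S = Ш(W)[2]`: a class of `Ш(80965b1)[2]` capitulates in `ℚ(√−151)`); kit `j291953` (class/sign readings) and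
`j292363` (explicit points, `g8/wit/wit-j292363.out`: `W^{(−879)}` minimal `[0,0,1,−1561941170148,751354884318179434]`, `ellrank` `[1,1,2]`,
`P = (140924588278/205209, 4724117722924309/92959677)`, `x(P) ≈ 686 737 < e₁ = 721 639.3…` — egg; `W^{(−151)}` minimal
`[0,−1,1,−46093619961,3809000962990821]`, `x(P) = 267814877821/2152089 > e₁ = 123967.95…` — identity component). WITNESS CORRECTED at the typer port
per REF1-AUDIT §35: the planner's sketch quoted `d = −11` (`W^{(−11)}` minimal `[0,1,1,−244608921,1472422670560]`, `P = (8986, 7137)` on the egg), which is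
`≡ 5 (mod 8)` — `DescAdmissibleUnram`, not `DescAdmissible` — so it does not witness THIS statement; `d = −879 ≡ 1 (mod 8)` does (REF1: 34 classes have
`θ = −` twists of both component types with `d ≡ 1 (8)`). In the census the identity-component case has frequency 1 429/3 261 = 0.438 among `θ = −`
twists (prediction DESC-E: `3/7`). -/
def OddBranchGeneratorComponentVariesAtTwo : Prop :=
  ∃ (W : WeierstrassCurve ℚ) (_ : W.IsElliptic) (_ : W.IsGloballyMinimal) (d d' : ℤ),
    OnOddBranchAtTwo W ∧ DescAdmissible W d ∧ DescAdmissible W d' ∧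
      EggCasselsTateBitAtTwo W d ∧
      (¬ ShaTwoInTwiceShaFour (W.quadraticTwist (d' : ℚ)) ∧ ¬ MeetsEgg (W.quadraticTwist (d' : ℚ)))

end Summit.BirchSwinnertonDyer.Rank1Residual.F1Sign2

end
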